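import Mathlib
import HarnessLib
import Literature.NumberTheory.Automorphic.IsobaricRigidityRepData
import Literature.NumberTheory.Automorphic.GaloisActionPlaces
import Literature.NumberTheory.Automorphic.KimExteriorSquareGL4Lemmas
import Literature.NumberTheory.Automorphic.KimExteriorSquareGL4Proofs
import Literature.NumberTheory.Automorphic.TunnellOctahedralGlobalProofs
import Literature.NumberTheory.Automorphic.ArthurClozelCuspidalDescentGLOneHolds
import Literature.NumberTheory.Automorphic.AutomorphicTwistHecke
import Literature.NumberTheory.Automorphic.HeckeCharacterPairRigidity
import Literature.NumberTheory.Automorphic.RamakrishnanMultiplicityOneDihedral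
import Literature.NumberTheory.Automorphic.AsaiAtOneRankOne
import Literature.NumberTheory.Automorphic.CuspidalDescentCyclicRepData
import Literature.NumberTheory.Automorphic.AutomorphicTwistNorm
import Literature.NumberTheory.Automorphic.IdeleNormDetGL
import Literature.NumberTheory.GaloisRepresentations.HeckeCharacter

set_option linter.unusedVariables false
set_option linter.dupNamespace false

noncomputable section

namespace Summit.Langlands.Langlands.Theorems.InducedSquareAscentKleinCube

open scoped Classical NumberField
open Filter IsDedekindDomain NumberField
open Literature.NumberTheory.Automorphic
open Literature.NumberTheory.GaloisRepresentations (HeckeCharacter)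

/-! ### Small algebraic helpers -/

/-- For a real base `x > 1`, `x ^ r = 1` forces `r = 0`. [folklore] -/
theorem rpow_eq_one_imp_eq_zero {x r : ℝ} (hx : 1 < x) (h : x ^ r = 1) : r = 0 := by
  rcases lt_trichotomy r 0 with hr | hr | hr
  · exact absurd h (Real.rpow_lt_one_of_one_lt_of_neg hx hr).ne
  · exact hr
  · exact absurd h (Real.one_lt_rpow hx hr).ne'

/-- `q^{-2s} · (q^{s})² = 1` for `q ≠ 0`. [folklore] -/
theorem cpow_neg_two_mul_mul_sq {q : ℂ} (hq : q ≠ 0) (s : ℂ) :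
    q ^ (-(2 * s)) * (q ^ s) ^ 2 = 1 := by
  rw [← Complex.cpow_nat_mul, Nat.cast_ofNat, Complex.cpow_neg, inv_mul_cancel₀]
  exact fun h => hq ((Complex.cpow_eq_zero_iff _ _).1 h).1

/-- `q^{-2s} · q^{s} = (q^{s})⁻¹` for `q ≠ 0`. [folklore] -/
theorem cpow_neg_two_mul_mul {q : ℂ} (hq : q ≠ 0) (s : ℂ) :
    q ^ (-(2 * s)) * q ^ s = (q ^ s)⁻¹ := by
  rw [← Complex.cpow_add _ _ hq, ← Complex.cpow_neg]; congr 1; ring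

/-- `∏ (-γ) = (-1)^{#γ} ∏ γ`. [folklore] -/
theorem prod_map_neg' (γ : Multiset ℂ) :
    (γ.map (fun c => -c)).prod = (-1) ^ γ.card * γ.prod :=
  Multiset.prod_map_neg γ

/-- `∏ γ² = (∏ γ)²`. [folklore] -/
theorem prod_map_sq (γ : Multiset ℂ) : (γ.map (fun c => c ^ 2)).prod = γ.prod ^ 2 := by
  rw [Multiset.prod_map_pow, Multiset.map_id']

/-- Scaling a multiset by `e` and then by `e'` with `e' e = 1` gives it back. [folklore] -/
theorem map_mul_map_mul_of_mul_eq_one {e e' : ℂ} (h : e' * e = 1) (m : Multiset ℂ) :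
    (m.map (e * ·)).map (e' * ·) = m := by
  rw [Multiset.map_map]
  conv_rhs => rw [← Multiset.map_id m]
  refine Multiset.map_congr rfl fun x _ => ?_
  simp only [Function.comp_apply, id_eq, ← mul_assoc, h, one_mul]

/-- The product of a scaled multiset of three elements: `∏ (c • β) = c³ ∏ β`. [folklore] -/
theorem prod_map_mul_of_card_eq_three (β : Multiset ℂ) (c : ℂ) (h3 : β.card = 3) :
    (β.map (fun x => c * x)).prod = c ^ 3 * β.prod := by
  rw [Multiset.prod_map_mul, Multiset.map_const', Multiset.prod_replicate, Multiset.map_id', h3]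

/-! ### Places of a quadratic extension -/

/-- In a quadratic extension `L/K`, two distinct places `w₁ ≠ w₂` above the same place `v` have
residue degree one, so `q_{w₁} = q_v`. [folklore] -/
theorem residueCard_eq_of_ne {K L : Type} [Field K] [NumberField K] [Field L] [NumberField L]
    [Algebra K L] (h2 : Module.finrank K L = 2) {v : HeightOneSpectrum (𝓞 K)}
    {w₁ w₂ : HeightOneSpectrum (𝓞 L)} (hne : w₁ ≠ w₂)
    (hw₁ : w₁.asIdeal.under (𝓞 K) = v.asIdeal) (hw₂ : w₂.asIdeal.under (𝓞 K) = v.asIdeal) :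
    w₁.residueCard = v.residueCard := by
  haveI : Algebra.IsQuadraticExtension K L := ⟨h2⟩
  have hu₁ : w₁.under (𝓞 K) = v := HeightOneSpectrum.ext hw₁
  have hu₂ : w₂.under (𝓞 K) = v := HeightOneSpectrum.ext hw₂
  obtain ⟨σ, hσ⟩ := HeightOneSpectrum.exists_algEquiv_smul_eq K (hu₁.trans hu₂.symm)
  have hσne : σ • w₁ ≠ w₁ := fun h => hne (h.symm.trans hσ)
  have hf : w₁.asIdeal.inertiaDeg (𝓞 K) = 1 :=
    HeightOneSpectrum.inertiaDeg_eq_one_of_smul_ne h2 hσne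
  rw [residueCard_eq_pow_inertiaDeg (F := K) w₁, hf, pow_one, hu₁]

/-! ### Transfer of the matching hypothesis through the `|det|`-twists at one place -/

/-- **Pointwise transfer of the exterior-square / automorphic-induction matching through the
unitary normalisation.** If `t_{P₀,w} = q_w^{-2s} t_{P,w}` at every place and the matching holds at
`v` for the parameter `q_v^{s} α₀` of `π` against `P`, then it holds at `v` for `α₀` against `P₀`
(`∧²(c α) = c² ∧²α`, `q_w = q_v` at split places, `q_w = q_v²` at the inert ones). [folklore] -/
theorem transfer_at {K : Type} [Field K] [NumberField K] {L : Type} [Field L] [NumberField L]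
    [Algebra K L] (h2 : Module.finrank K L = 2) {hL3 : isCompact_glFiniteIntegralLevel 3 L}
    {P P₀ : AutomorphicRepData (AutomorphyDatum.gl 3 L hL3)} {s : ℂ}
    (hP₀ : ∀ (w : HeightOneSpectrum (𝓞 L)) (β : Multiset ℂ), P.HasSatakeParamAt w β →
      P₀.HasSatakeParamAt w (β.map (fun x => (w.residueCard : ℂ) ^ (-(2 * s)) * x)))
    {v : HeightOneSpectrum (𝓞 K)} {α₀ : Multiset ℂ}
    (hsplit : (∃ w : HeightOneSpectrum (𝓞 L), w.asIdeal.under (𝓞 K) = v.asIdeal ∧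
        w.asIdeal.inertiaDeg (𝓞 K) = 1) →
      ∃ w₁ w₂ : HeightOneSpectrum (𝓞 L), w₁ ≠ w₂ ∧ w₁.asIdeal.under (𝓞 K) = v.asIdeal ∧
        w₂.asIdeal.under (𝓞 K) = v.asIdeal ∧ ∃ β₁ β₂ : Multiset ℂ, P.HasSatakeParamAt w₁ β₁ ∧
          P.HasSatakeParamAt w₂ β₂ ∧
            ((α₀.map (fun x => (v.residueCard : ℂ) ^ s * x)).powersetCard 2).map Multiset.prod =
              β₁ + β₂)
    (hinert : (¬ ∃ w : HeightOneSpectrum (𝓞 L), w.asIdeal.under (𝓞 K) = v.asIdeal ∧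
        w.asIdeal.inertiaDeg (𝓞 K) = 1) →
      ∃ w : HeightOneSpectrum (𝓞 L), w.asIdeal.under (𝓞 K) = v.asIdeal ∧
        ∃ β γ : Multiset ℂ, P.HasSatakeParamAt w β ∧ γ.map (fun c => c ^ 2) = β ∧
          ((α₀.map (fun x => (v.residueCard : ℂ) ^ s * x)).powersetCard 2).map Multiset.prod =
            γ + γ.map (fun c => -c)) :
    ((∃ w : HeightOneSpectrum (𝓞 L), w.asIdeal.under (𝓞 K) = v.asIdeal ∧
        w.asIdeal.inertiaDeg (𝓞 K) = 1) →
      ∃ w₁ w₂ : HeightOneSpectrum (𝓞 L), w₁ ≠ w₂ ∧ w₁.asIdeal.under (𝓞 K) = v.asIdeal ∧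
        w₂.asIdeal.under (𝓞 K) = v.asIdeal ∧ ∃ β₁ β₂ : Multiset ℂ,
          P₀.HasSatakeParamAt w₁ β₁ ∧ P₀.HasSatakeParamAt w₂ β₂ ∧
            (α₀.powersetCard 2).map Multiset.prod = β₁ + β₂) ∧
    ((¬ ∃ w : HeightOneSpectrum (𝓞 L), w.asIdeal.under (𝓞 K) = v.asIdeal ∧
        w.asIdeal.inertiaDeg (𝓞 K) = 1) →
      ∃ w : HeightOneSpectrum (𝓞 L), w.asIdeal.under (𝓞 K) = v.asIdeal ∧
        ∃ β γ : Multiset ℂ, P₀.HasSatakeParamAt w β ∧ γ.map (fun c => c ^ 2) = β ∧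
          (α₀.powersetCard 2).map Multiset.prod = γ + γ.map (fun c => -c)) := by
  have hq0 : (v.residueCard : ℂ) ≠ 0 :=
    Nat.cast_ne_zero.2 (by have := v.one_lt_residueCard; omega)
  have hdc := cpow_neg_two_mul_mul_sq hq0 s
  rw [← wedgeTwoParams_def]
  refine ⟨fun hex => ?_, fun hnex => ?_⟩
  · obtain ⟨w₁, w₂, hne, hw₁, hw₂, β₁, β₂, hβ₁, hβ₂, heq⟩ := hsplit hex
    rw [← wedgeTwoParams_def, wedgeTwoParams_map_mul] at heq
    have hq₁ : w₁.residueCard = v.residueCard := residueCard_eq_of_ne h2 hne hw₁ hw₂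
    have hq₂ : w₂.residueCard = v.residueCard := residueCard_eq_of_ne h2 hne.symm hw₂ hw₁
    refine ⟨w₁, w₂, hne, hw₁, hw₂, _, _, hP₀ w₁ β₁ hβ₁, hP₀ w₂ β₂ hβ₂, ?_⟩
    rw [hq₁, hq₂, ← Multiset.map_add, ← heq, map_mul_map_mul_of_mul_eq_one hdc]
  · obtain ⟨w, hw, β, γ, hβ, hγ, heq⟩ := hinert hnex
    rw [← wedgeTwoParams_def, wedgeTwoParams_map_mul] at heq
    have hf : w.asIdeal.inertiaDeg (𝓞 K) = 2 := by
      rcases inertiaDeg_eq_one_or_two_of_finrank_eq_two h2 v w hw with h | h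
      · exact absurd ⟨w, hw, h⟩ hnex
      · exact h
    have hwv : w.under (𝓞 K) = v := HeightOneSpectrum.ext hw
    have hq : w.residueCard = v.residueCard ^ 2 := by
      rw [residueCard_eq_pow_inertiaDeg (F := K) w, hf, hwv]
    refine ⟨w, hw, _, γ.map (fun x => (v.residueCard : ℂ) ^ (-(2 * s)) * x), hP₀ w β hβ, ?_, ?_⟩
    · rw [hq, natCast_pow_cpow, ← hγ, Multiset.map_map, Multiset.map_map]
      refine Multiset.map_congr rfl fun x _ => ?_
      simp only [Function.comp_apply]
      ring
    · rw [← map_mul_map_mul_of_mul_eq_one hdc (wedgeTwoParams α₀), heq, Multiset.map_add,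
        Multiset.map_map, Multiset.map_map]
      congr 1
      refine Multiset.map_congr rfl fun x _ => ?_
      simp only [Function.comp_apply, mul_neg]

/-! ### The stub -/

/-- **Reduction to unitary data** (Borel–Jacquet 1979, 5.7, in the Borel–Jacquet model of the
tree): from `π` cuspidal on `GL₄/K`, `L/K` quadratic and `P` cuspidal on `GL₃/L` with the
exterior-square / automorphic-induction matching, the unitary avatars `π₀ = π ⊗ |det|^{-s}`
(`CuspidalAutomorphicRepData.exists_unitary_avatar`) and `P₀ = P ⊗ |det|_L^{-2s}`
(`exists_cuspidalAutomorphicRepData_map_mulChar_detTwist`) have unitary zero-free Satake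
parameters almost everywhere, satisfy the same matching, and the two conclusions (essential
self-duality by a Hecke character, `ε_{L/K}`-self-twist) transport back to `π`. [folklore] -/
theorem stub_unitaryReduction :
    ∀ (K : Type) [Field K] [NumberField K] (h1 : isCompact_glFiniteIntegralLevel 1 K)
      (hcpt : isCompact_glFiniteIntegralLevel 4 K) (π : CuspidalAutomorphicRepData 4 K hcpt)
      (L : Type) [Field L] [NumberField L] [Algebra K L], Module.finrank K L = 2 →
      ∀ (hL3 : isCompact_glFiniteIntegralLevel 3 L) (P : CuspidalAutomorphicRepData 3 L hL3),
      (∀ᶠ v : HeightOneSpectrum (𝓞 K) in cofinite, ∀ α : Multiset ℂ, π.1.HasSatakeParamAt v α →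
        ((∃ w : HeightOneSpectrum (𝓞 L), w.asIdeal.under (𝓞 K) = v.asIdeal ∧
            w.asIdeal.inertiaDeg (𝓞 K) = 1) →
          ∃ w₁ w₂ : HeightOneSpectrum (𝓞 L), w₁ ≠ w₂ ∧ w₁.asIdeal.under (𝓞 K) = v.asIdeal ∧
            w₂.asIdeal.under (𝓞 K) = v.asIdeal ∧ ∃ β₁ β₂ : Multiset ℂ, P.1.HasSatakeParamAt w₁ β₁ ∧
              P.1.HasSatakeParamAt w₂ β₂ ∧ (α.powersetCard 2).map Multiset.prod = β₁ + β₂) ∧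
        ((¬ ∃ w : HeightOneSpectrum (𝓞 L), w.asIdeal.under (𝓞 K) = v.asIdeal ∧
            w.asIdeal.inertiaDeg (𝓞 K) = 1) →
          ∃ w : HeightOneSpectrum (𝓞 L), w.asIdeal.under (𝓞 K) = v.asIdeal ∧
            ∃ β γ : Multiset ℂ, P.1.HasSatakeParamAt w β ∧ γ.map (fun c => c ^ 2) = β ∧
              (α.powersetCard 2).map Multiset.prod = γ + γ.map (fun c => -c))) →
      ∃ (π₀ : CuspidalAutomorphicRepData 4 K hcpt) (P₀ : CuspidalAutomorphicRepData 3 L hL3),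
        (∀ᶠ v : HeightOneSpectrum (𝓞 K) in cofinite, ∀ α : Multiset ℂ, π₀.1.HasSatakeParamAt v α →
          ‖α.prod‖ = 1 ∧ ∀ a ∈ α, a ≠ 0) ∧
        (∀ᶠ w : HeightOneSpectrum (𝓞 L) in cofinite, ∀ β : Multiset ℂ, P₀.1.HasSatakeParamAt w β →
          ‖β.prod‖ = 1 ∧ ∀ b ∈ β, b ≠ 0) ∧
        (∀ᶠ v : HeightOneSpectrum (𝓞 K) in cofinite, ∀ α : Multiset ℂ, π₀.1.HasSatakeParamAt v α →
          ((∃ w : HeightOneSpectrum (𝓞 L), w.asIdeal.under (𝓞 K) = v.asIdeal ∧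
              w.asIdeal.inertiaDeg (𝓞 K) = 1) →
            ∃ w₁ w₂ : HeightOneSpectrum (𝓞 L), w₁ ≠ w₂ ∧ w₁.asIdeal.under (𝓞 K) = v.asIdeal ∧
              w₂.asIdeal.under (𝓞 K) = v.asIdeal ∧ ∃ β₁ β₂ : Multiset ℂ,
                P₀.1.HasSatakeParamAt w₁ β₁ ∧ P₀.1.HasSatakeParamAt w₂ β₂ ∧
                  (α.powersetCard 2).map Multiset.prod = β₁ + β₂) ∧
          ((¬ ∃ w : HeightOneSpectrum (𝓞 L), w.asIdeal.under (𝓞 K) = v.asIdeal ∧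
              w.asIdeal.inertiaDeg (𝓞 K) = 1) →
            ∃ w : HeightOneSpectrum (𝓞 L), w.asIdeal.under (𝓞 K) = v.asIdeal ∧
              ∃ β γ : Multiset ℂ, P₀.1.HasSatakeParamAt w β ∧ γ.map (fun c => c ^ 2) = β ∧
                (α.powersetCard 2).map Multiset.prod = γ + γ.map (fun c => -c))) ∧
        ((∃ χ : HeckeCharacter K, ∀ᶠ v : HeightOneSpectrum (𝓞 K) in cofinite, ∀ α : Multiset ℂ,
            π₀.1.HasSatakeParamAt v α →
              α.map (fun a => a⁻¹) = α.map (fun a => χ.valueAtUniformizer v * a)) →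
          ∃ η : CuspidalAutomorphicRepData 1 K h1, ∀ᶠ v in cofinite, ∀ α : Multiset ℂ,
            π.1.HasSatakeParamAt v α →
              ∃ e : ℂ, η.1.HasSatakeParamAt v {e} ∧ α.map (fun a => a⁻¹) = α.map (fun a => e * a)) ∧
        ((∀ᶠ v : HeightOneSpectrum (𝓞 K) in cofinite, ∀ α : Multiset ℂ, π₀.1.HasSatakeParamAt v α →
            α.map (fun a => quadraticSign L v * a) = α) →
          ∀ᶠ v : HeightOneSpectrum (𝓞 K) in cofinite, ∀ α : Multiset ℂ, π.1.HasSatakeParamAt v α →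
            α.map (fun a => quadraticSign L v * a) = α) := by
  intro K _ _ h1 hcpt π L _ _ _ h2 hL3 P hH
  -- (a) the unitary avatar of `π`
  obtain ⟨s, S, α, πu, hS, hiff, hπu, hunit, hcard⟩ :=
    CuspidalAutomorphicRepData.exists_unitary_avatar hcpt π
  have hq0 : ∀ v : HeightOneSpectrum (𝓞 K), (v.residueCard : ℂ) ≠ 0 := fun v =>
    Nat.cast_ne_zero.2 (by have := v.one_lt_residueCard; omega)
  -- (b) `P₀ = P ⊗ |det|_L^{-2s}`
  obtain ⟨ν, hν⟩ := exists_heckeCharacter_ideleNorm_cpow L (2 * s)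
  obtain ⟨P₀, hW, hW'⟩ := exists_cuspidalAutomorphicRepData_map_mulChar_detTwist hν P
  have hP₀ : ∀ (w : HeightOneSpectrum (𝓞 L)) (β : Multiset ℂ), P.1.HasSatakeParamAt w β →
      P₀.1.HasSatakeParamAt w (β.map (fun x => (w.residueCard : ℂ) ^ (-(2 * s)) * x)) :=
    fun w β h => AutomorphicRepData.HasSatakeParamAt.of_map_mulChar_detTwist_of_cpow hν hW hW' h
  -- the Satake parameters of `π` off `S`
  have hπv : ∀ v ∉ S, π.1.HasSatakeParamAt v ((α v).map (fun x => (v.residueCard : ℂ) ^ s * x)) :=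
    fun v hv => (hiff v hv _).2 rfl
  refine ⟨πu, P₀, ?_, ?_, ?_, ?_, ?_⟩
  · -- unitarity of `π₀`
    filter_upwards [hS.eventually_cofinite_notMem] with v hv α₀ hα₀
    have hαeq : α₀ = α v := AutomorphicRepData.hasSatakeParamAt_unique_holds πu.1 hα₀ (hπu v hv)
    subst hαeq
    refine ⟨hunit v hv, fun a ha h0 => ?_⟩
    have h := hunit v hv
    subst h0
    rw [Multiset.prod_eq_zero ha, norm_zero] at h
    exact zero_ne_one h
  · -- unitarity of `P₀`
    obtain ⟨s', S', α', P₀u, hS', hiff', -, hunit', hcard'⟩ :=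
      CuspidalAutomorphicRepData.exists_unitary_avatar hL3 P₀
    have hnorm : ∀ w ∉ S', ∀ β : Multiset ℂ, P₀.1.HasSatakeParamAt w β →
        ‖β.prod‖ = ((w.residueCard : ℝ) ^ s'.re) ^ 3 := by
      intro w hw β hβ
      rw [(hiff' w hw β).1 hβ, prod_map_mul_of_card_eq_three _ _ (hcard' w hw), norm_mul, norm_pow,
        hunit' w hw, mul_one,
        Complex.norm_natCast_cpow_of_pos (lt_trans zero_lt_one w.one_lt_residueCard)]
    have hre : s'.re = 0 := by
      haveI : Infinite (HeightOneSpectrum (𝓞 K)) := infinite_heightOneSpectrum K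
      obtain ⟨v₀, hv₀S, hHv₀, hv₀S'⟩ := (hS.eventually_cofinite_notMem.and (hH.and
        (eventually_forall_under_eq (F := K) hS'.eventually_cofinite_notMem))).exists
      obtain ⟨hT1, hT2⟩ := transfer_at h2 hP₀ (hHv₀ _ (hπv v₀ hv₀S)).1 (hHv₀ _ (hπv v₀ hv₀S)).2
      have hw1 : ‖(wedgeTwoParams (α v₀)).prod‖ = 1 := by
        rw [prod_wedgeTwoParams_of_card_eq_four (hcard v₀ hv₀S), norm_pow, hunit v₀ hv₀S, one_pow]
      by_cases hex : ∃ w : HeightOneSpectrum (𝓞 L), w.asIdeal.under (𝓞 K) = v₀.asIdeal ∧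
          w.asIdeal.inertiaDeg (𝓞 K) = 1
      · obtain ⟨w₁, w₂, hne, hw₁, hw₂, β₁, β₂, hβ₁, hβ₂, heq⟩ := hT1 hex
        rw [wedgeTwoParams_def, heq, Multiset.prod_add, norm_mul, hnorm w₁ (hv₀S' w₁ hw₁) β₁ hβ₁,
          hnorm w₂ (hv₀S' w₂ hw₂) β₂ hβ₂, residueCard_eq_of_ne h2 hne hw₁ hw₂,
          residueCard_eq_of_ne h2 hne.symm hw₂ hw₁, ← pow_add] at hw1
        have hx : (1 : ℝ) < (v₀.residueCard : ℝ) := Nat.one_lt_cast.2 v₀.one_lt_residueCard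
        exact rpow_eq_one_imp_eq_zero hx
          ((pow_eq_one_iff_of_nonneg (Real.rpow_nonneg (Nat.cast_nonneg _) _) (by norm_num)).1 hw1)
      · obtain ⟨w, hw, β, γ, hβ, hγ, heq⟩ := hT2 hex
        rw [wedgeTwoParams_def, heq, Multiset.prod_add, prod_map_neg', norm_mul, norm_mul, norm_pow,
          norm_neg, norm_one, one_pow, one_mul] at hw1
        have hβn : ‖β.prod‖ = 1 := by rw [← hγ, prod_map_sq, norm_pow, pow_two, hw1]
        rw [hnorm w (hv₀S' w hw) β hβ] at hβn
        have hx : (1 : ℝ) < (w.residueCard : ℝ) := Nat.one_lt_cast.2 w.one_lt_residueCard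
        exact rpow_eq_one_imp_eq_zero hx
          ((pow_eq_one_iff_of_nonneg (Real.rpow_nonneg (Nat.cast_nonneg _) _) (by norm_num)).1 hβn)
    filter_upwards [hS'.eventually_cofinite_notMem] with w hw β hβ
    have hn : ‖β.prod‖ = 1 := by rw [hnorm w hw β hβ, hre, Real.rpow_zero, one_pow]
    refine ⟨hn, fun b hb hb0 => ?_⟩
    subst hb0
    rw [Multiset.prod_eq_zero hb, norm_zero] at hn
    exact zero_ne_one hn
  · -- the matching hypothesis for `(π₀, P₀)`
    filter_upwards [hS.eventually_cofinite_notMem, hH] with v hvS hHv α₀ hα₀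
    have hαeq : α₀ = α v := AutomorphicRepData.hasSatakeParamAt_unique_holds πu.1 hα₀ (hπu v hvS)
    subst hαeq
    exact transfer_at h2 hP₀ (hHv _ (hπv v hvS)).1 (hHv _ (hπv v hvS)).2
  · -- transport of the essential self-duality
    rintro ⟨χ, hχ⟩
    obtain ⟨νK, hνK⟩ := exists_heckeCharacter_ideleNorm_cpow K (2 * s)
    obtain ⟨η, hη⟩ := exists_cuspidal_glOne_hasSatakeParamAt_valueAtUniformizer' h1 (χ * νK)
    refine ⟨η, ?_⟩
    filter_upwards [hS.eventually_cofinite_notMem, hχ, hη] with v hvS hχv hηv α₁ hα₁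
    refine ⟨(χ * νK).valueAtUniformizer v, hηv, ?_⟩
    have hαeq : α₁ = (α v).map (fun x => (v.residueCard : ℂ) ^ s * x) := (hiff v hvS α₁).1 hα₁
    have hinv : (α v).map (fun a => a⁻¹) = (α v).map (fun a => χ.valueAtUniformizer v * a) :=
      hχv _ (hπu v hvS)
    have he := cpow_neg_two_mul_mul (hq0 v) s
    rw [HeckeCharacter.valueAtUniformizer_mul, HeckeCharacter.valueAtUniformizer_normTwist hνK, hαeq,
      Multiset.map_map, Multiset.map_map]
    calc Multiset.map ((fun a => a⁻¹) ∘ fun x => (v.residueCard : ℂ) ^ s * x) (α v)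
        = ((α v).map (fun a => a⁻¹)).map (fun x => ((v.residueCard : ℂ) ^ s)⁻¹ * x) := by
          rw [Multiset.map_map]
          refine Multiset.map_congr rfl fun x _ => ?_
          simp only [Function.comp_apply, mul_inv]
      _ = ((α v).map (fun a => χ.valueAtUniformizer v * a)).map
            (fun x => ((v.residueCard : ℂ) ^ s)⁻¹ * x) := by rw [hinv]
      _ = _ := by
          rw [Multiset.map_map]
          refine Multiset.map_congr rfl fun x _ => ?_
          simp only [Function.comp_apply]
          rw [← he]
          ring
  · -- transport of the `ε_{L/K}`-self-twist
    intro hε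
    filter_upwards [hS.eventually_cofinite_notMem, hε] with v hvS hεv α₁ hα₁
    have hαeq : α₁ = (α v).map (fun x => (v.residueCard : ℂ) ^ s * x) := (hiff v hvS α₁).1 hα₁
    have hfix : (α v).map (fun a => quadraticSign L v * a) = α v := hεv _ (hπu v hvS)
    rw [hαeq, Multiset.map_map]
    calc Multiset.map ((fun a => quadraticSign L v * a) ∘ fun x => (v.residueCard : ℂ) ^ s * x) (α v)
        = ((α v).map (fun a => quadraticSign L v * a)).map (fun x => (v.residueCard : ℂ) ^ s * x) := by
          rw [Multiset.map_map]
          refine Multiset.map_congr rfl fun x _ => ?_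
          simp only [Function.comp_apply]
          ring
      _ = (α v).map (fun x => (v.residueCard : ℂ) ^ s * x) := by rw [hfix]

end Summit.Langlands.Langlands.Theorems.InducedSquareAscentKleinCube

end
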